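import Summits.AnomalousDissipation.AnomalousDissipation.Theses.WindLine
import Literature.Analysis.FluidPDE.SteadyGalerkinApprox

/-!
# Route WindLine (AnomalousDissipation) — `WindLineFeedsTarget`

Settles stmt-AnomalousDissipation-11423 (support item `WindLineFeedsTarget` of route
`AnomalousDissipation/WindLine`): the bookkeeping edge crux #2 → thesis X,
`CyclicWindLineLoud → WindyGalerkinSteadyZerothLaw`.

Proof. Take for `f` the cyclic force `f(x) = (sin 2πx₃, sin 2πx₁, sin 2πx₂)` of the crux (literally its lambda),
keep `ν, E, ε`, and for every resolution `N` served by the crux and every loud bounded zero `c ∈ V` of the windy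
Galerkin field on `S = freqBall N` put `u := realTrigPoly S (coeffExt S c)`:

* `f` is an explicit real trigonometric polynomial on the first shell
  `{±e₁, ±e₂, ±e₃}` with transversal coefficients `f̂(k) = -(i/2)(k₃, k₁, k₂)`, hence smooth, divergence free
  and (since `0 ∉` shell) mean zero (`cycForce_eq_realTrigPoly`, `isSmooth_cycForce`, `isDivFree_cycForce`,
  `hasZeroMean_cycForce`);
* `u` is smooth (`isSmooth_realTrigPoly`), divergence free (`isDivFree_realTrigPoly`, `c` is solenoidal), band-limited
  to `S` (`mFourierCoeff_realTrigPoly_eq_zero`, `c` is real and `S` symmetric);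
* the tested Galerkin equations against every smooth divergence-free `a` band-limited to `S ∖ {0} ⊆ S` follow
  from the master identity `sum_re_inner_galerkinField_test` (whose left-hand side vanishes termwise at a zero of
  `galerkinRHS`) with the force term rewritten by Parseval (`integral_inner_realTrigPoly_mFourierCoeff_eq`) —
  `integral_tested_eq_zero_of_galerkinRHS_eq_zero`, any smooth force, any symmetric `S`;
* `∫ ‖u‖² = Σ ‖c k‖²` (`integral_norm_sq_realTrigPoly`) and `‖∇u‖² = 4π² Σ |k|² ‖c k‖²`
  (`gradNormSq_eq_toReal_eGradNormSq_holds`, `toReal_eGradNormSq_realTrigPoly`), so the energy bound and the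
  loudness pass through verbatim; `∃ᶠ N` is transported by `Filter.Frequently.mono`.

References: J. C. Robinson, J. L. Rodrigo, W. Sadowski, *The three-dimensional Navier–Stokes equations*
(CUP 2016), §4.1, (4.5) (the Fourier–Galerkin system); P. Constantin, C. Foias, *Navier–Stokes Equations* (1988),
Ch. 8, (8.3)–(8.7); R. Temam, *Navier–Stokes Equations* (1979), Ch. II §1 (tested steady Galerkin equations).
-/

-- `Summit.<Summit>.<Problem>` is the tree's mandated summit-side namespace (CONVENTIONS §2); for this
-- single-conjunct summit the two coincide, so the duplicate is deliberate.
set_option linter.dupNamespace false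

noncomputable section

open scoped InnerProductSpace ComplexConjugate
open MeasureTheory Filter
open Literature.Analysis.FunctionSpaces Literature.Analysis.FunctionSpaces.Torus
open Literature.Analysis.FluidPDE

namespace Summit.AnomalousDissipation.AnomalousDissipation.Theorems

namespace WindLineCyclic

/-! ## The cyclic force is a real trigonometric polynomial on the first shell

The cyclic force is the literal lambda `fun x => !₂[Im e₁(x₃), Im e₁(x₁), Im e₁(x₂)]` of `CyclicWindLineLoud`
(`sin 2πt = Im e₁(t)`); its forcing shell is the first shell `{±e₃, ±e₁, ±e₂}` (`|k|² = 1`), written as an explicit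
six-element `Finset`, and its Fourier coefficients there are `f̂(k) = -(i/2)(k₃, k₁, k₂) = ½(-i k₃, -i k₁, -i k₂)`.
No notation or definition is introduced for these three literals (they are spelled out where used). -/

/-- Sums over the first shell `{±e₃, ±e₁, ±e₂}`, expanded into six terms. [folklore] -/
theorem sum_cycShell (F : (Fin 3 → ℤ) → ℂ) :
    ∑ k ∈ ({![0, 0, 1], ![0, 0, -1], ![1, 0, 0], ![-1, 0, 0], ![0, 1, 0], ![0, -1, 0]} : Finset (Fin 3 → ℤ)), F k =
      F ![0, 0, 1] + F ![0, 0, -1] + F ![1, 0, 0] + F ![-1, 0, 0] + F ![0, 1, 0] + F ![0, -1, 0] := by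
  rw [Finset.sum_insert (by decide), Finset.sum_insert (by decide), Finset.sum_insert (by decide),
    Finset.sum_insert (by decide), Finset.sum_pair (by decide)]
  ring

/-- **The cyclic force is a real trigonometric polynomial on the first shell**:
`(sin 2πx₃, sin 2πx₁, sin 2πx₂) = Re Σ_{k ∈ {±e₃, ±e₁, ±e₂}} e_k(x) f̂(k)` with `f̂(k) = ½(-i k₃, -i k₁, -i k₂)`
(coordinatewise: `-(i/2)(e₁(t) - conj e₁(t)) = Im e₁(t)`; the characters of `T³` factor over the coordinates).
[folklore] -/
theorem cycForce_eq_realTrigPoly :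
    (fun x : UnitAddTorus (Fin 3) =>
        !₂[(fourier 1 (x 2) : ℂ).im, (fourier 1 (x 0) : ℂ).im, (fourier 1 (x 1) : ℂ).im]) =
      realTrigPoly ({![0, 0, 1], ![0, 0, -1], ![1, 0, 0], ![-1, 0, 0], ![0, 1, 0], ![0, -1, 0]} :
          Finset (Fin 3 → ℤ))
        (fun k : Fin 3 → ℤ => (((2⁻¹ : ℝ) : ℂ) •
          !₂[-(Complex.I * ((k 2 : ℤ) : ℂ)), -(Complex.I * ((k 0 : ℤ) : ℂ)), -(Complex.I * ((k 1 : ℤ) : ℂ))] :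
            EuclideanSpace ℂ (Fin 3))) := by
  funext x
  -- the Fourier character on `T³` factors over the three coordinates
  have h3 : ∀ k : Fin 3 → ℤ, UnitAddTorus.mFourier k x =
      fourier (k 0) (x 0) * fourier (k 1) (x 1) * fourier (k 2) (x 2) := fun k => by
    simp [UnitAddTorus.mFourier, Fin.prod_univ_three]
  ext i
  rw [realTrigPoly_apply_coord, trigPoly_apply_coord, sum_cycShell]
  fin_cases i <;>
  · simp only [Fin.reduceFinMk, Fin.isValue, Fin.zero_eta, Fin.mk_one, h3, Matrix.cons_val_zero,
      Matrix.cons_val_one, Matrix.cons_val_two, Matrix.head_cons, Matrix.tail_cons, fourier_zero, fourier_neg,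
      Int.cast_zero, Int.cast_one, Int.cast_neg, PiLp.smul_apply, smul_eq_mul, one_mul, mul_one, mul_zero,
      neg_zero, add_zero, zero_add, mul_neg]
    simp only [Complex.add_re, Complex.neg_re, Complex.mul_re, Complex.mul_im, Complex.conj_re, Complex.conj_im,
      Complex.I_re, Complex.I_im, Complex.ofReal_re, Complex.ofReal_im, mul_zero, mul_one, sub_zero, zero_sub,
      add_zero]
    ring

/-- The cyclic force is smooth (a trigonometric polynomial). [folklore] -/
theorem isSmooth_cycForce :
    IsSmooth (fun x : UnitAddTorus (Fin 3) =>
      !₂[(fourier 1 (x 2) : ℂ).im, (fourier 1 (x 0) : ℂ).im, (fourier 1 (x 1) : ℂ).im]) := by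
  rw [cycForce_eq_realTrigPoly]; exact isSmooth_realTrigPoly _ _

/-- The cyclic force is divergence free: its coefficients are transversal on the first shell, `k · f̂(k) = 0`
(each shell vector has a single nonzero coordinate `j`, and `f̂(k)ⱼ` carries a different coordinate of `k`).
[folklore] -/
theorem isDivFree_cycForce :
    IsDivFree (fun x : UnitAddTorus (Fin 3) =>
      !₂[(fourier 1 (x 2) : ℂ).im, (fourier 1 (x 0) : ℂ).im, (fourier 1 (x 1) : ℂ).im]) := by
  rw [cycForce_eq_realTrigPoly]
  refine isDivFree_realTrigPoly fun k hk => ?_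
  simp only [Finset.mem_insert, Finset.mem_singleton] at hk
  rcases hk with rfl | rfl | rfl | rfl | rfl | rfl <;> simp [Fin.sum_univ_three]

/-- The cyclic force has zero mean (the mean mode is not on the first shell). [folklore] -/
theorem hasZeroMean_cycForce :
    HasZeroMean (fun x : UnitAddTorus (Fin 3) =>
      !₂[(fourier 1 (x 2) : ℂ).im, (fourier 1 (x 0) : ℂ).im, (fourier 1 (x 1) : ℂ).im]) := by
  rw [cycForce_eq_realTrigPoly]; exact hasZeroMean_realTrigPoly_of_zero_not_mem (by decide) _

/-! ## Zeros of the Galerkin field are tested steady Galerkin states -/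

/-- **Zeros of the Fourier–Galerkin field solve the tested steady Galerkin equations.** Let `S` be a symmetric
frequency set, `f` a smooth force, `c ∈ galerkinSubspace S` (real, solenoidal) a zero of the Galerkin field driven
by the Fourier coefficients of `f` on `S`, and `u = realTrigPoly S (coeffExt S c)`. Then for every smooth
divergence-free `a` band-limited to `S`, `∫ (⟪u, (u·∇)a⟫ + ν ⟪u, Δa⟫ + ⟪f, a⟫) = 0`: the master identity
`sum_re_inner_galerkinField_test` has vanishing left-hand side, and its force term `∫ ⟪realTrigPoly S f̂, a⟫`
equals `∫ ⟪f, a⟫` by Parseval against the band-limited `a` (Robinson–Rodrigo–Sadowski 2016, (4.5); Temam 1979,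
Ch. II §1). [folklore] -/
theorem integral_tested_eq_zero_of_galerkinRHS_eq_zero {d : Type*} [Fintype d] [DecidableEq d]
    {S : Finset (d → ℤ)} (hS : ∀ k ∈ S, -k ∈ S) (ν : ℝ)
    {f : UnitAddTorus d → EuclideanSpace ℝ d} (hf : IsSmooth f)
    {c : ↥S → EuclideanSpace ℂ d} (hc : c ∈ galerkinSubspace S)
    (h0 : galerkinRHS S ν
      (fun k : ↥S => UnitAddTorus.mFourierCoeff (EuclideanSpace.complexify ∘ f) (k : d → ℤ)) c = 0)
    {a : UnitAddTorus d → EuclideanSpace ℝ d} (ha : IsSmooth a) (hdiv : IsDivFree a)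
    (hband : ∀ k ∉ S, UnitAddTorus.mFourierCoeff (EuclideanSpace.complexify ∘ a) k = 0) :
    ∫ x, (⟪realTrigPoly S (coeffExt S c) x, Torus.convect (realTrigPoly S (coeffExt S c)) a x⟫_ℝ +
        ν * ⟪realTrigPoly S (coeffExt S c) x, Torus.laplacian a x⟫_ℝ + ⟪f x, a x⟫_ℝ) = 0 := by
  set g : ↥S → EuclideanSpace ℂ d := fun k =>
    UnitAddTorus.mFourierCoeff (EuclideanSpace.complexify ∘ f) (k : d → ℤ) with hgdef
  have hfi : Integrable f volume := hf.integrable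
  have hgr : IsRealCoeff g := isRealCoeff_mFourierCoeff hfi
  have hCsymm : IsConjSymm (coeffExt S c) := hc.1.isConjSymm_coeffExt hS
  have hCT : IsTransversal S (coeffExt S c) := hc.2.isTransversal_coeffExt
  have hGg : realTrigPoly S (coeffExt S g) =
      realTrigPoly S fun k => UnitAddTorus.mFourierCoeff (EuclideanSpace.complexify ∘ f) k :=
    realTrigPoly_coeffExt_restrict _
  have hid := Torus.sum_re_inner_galerkinField_test ν hS (hgr.isConjSymm_coeffExt hS) hCsymm hCT ha hdiv hband
  have hzero : ∑ k ∈ S, (inner ℂ (Torus.galerkinField ν S (coeffExt S g) (coeffExt S c) k)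
      (UnitAddTorus.mFourierCoeff (EuclideanSpace.complexify ∘ a) k)).re = 0 := by
    refine Finset.sum_eq_zero fun k hk => ?_
    have hk0 : Torus.galerkinField ν S (coeffExt S g) (coeffExt S c) k = 0 := by
      have := congrFun h0 ⟨k, hk⟩
      rwa [galerkinRHS_apply] at this
    rw [hk0, inner_zero_left, Complex.zero_re]
  rw [hzero, hGg] at hid
  -- split off the force term and rewrite it by Parseval
  have hu : IsSmooth (realTrigPoly S (coeffExt S c)) := isSmooth_realTrigPoly _ _
  have hGs : IsSmooth (realTrigPoly S fun k => UnitAddTorus.mFourierCoeff (EuclideanSpace.complexify ∘ f) k) :=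
    isSmooth_realTrigPoly _ _
  have i1 : Integrable (fun x => ⟪realTrigPoly S (coeffExt S c) x,
      Torus.convect (realTrigPoly S (coeffExt S c)) a x⟫_ℝ +
      ν * ⟪realTrigPoly S (coeffExt S c) x, Torus.laplacian a x⟫_ℝ) volume :=
    ((hu.continuous.inner (hu.convect ha).continuous).add
      ((hu.continuous.inner ha.laplacian.continuous).const_smul ν)).integrable_unitAddTorus
  have i2 : Integrable (fun x => ⟪realTrigPoly S
      (fun k => UnitAddTorus.mFourierCoeff (EuclideanSpace.complexify ∘ f) k) x, a x⟫_ℝ) volume :=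
    (hGs.continuous.inner ha.continuous).integrable_unitAddTorus
  have i3 : Integrable (fun x => ⟪f x, a x⟫_ℝ) volume :=
    (hf.continuous.inner ha.continuous).integrable_unitAddTorus
  have hforce := integral_inner_realTrigPoly_mFourierCoeff_eq hS (hf.memLp 2) (ha.memLp 2) hband
  rw [integral_add i1 i2, hforce, ← integral_add i1 i3] at hid
  exact hid.symm

end WindLineCyclic

open WindLineCyclic in
/-- **Crux #2 feeds the target** (stmt-AnomalousDissipation-11423): loud bounded zeros of the windy Galerkin
field for the cyclic force along `ν_j → 0⁺` at infinitely many resolutions (`CyclicWindLineLoud`) give the windy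
Galerkin steady zeroth law (`WindyGalerkinSteadyZerothLaw`) with the witness force `f :=` the cyclic force —
smooth, divergence free, mean zero — the same `ν, E, ε`, and at each served `N` the field
`u = realTrigPoly S (coeffExt S c)` of the served zero `c`: smooth, divergence free, band-limited to
`S = freqBall N`, solving the tested Galerkin equations (`integral_tested_eq_zero_of_galerkinRHS_eq_zero`), with
`∫ ‖u‖² = Σ ‖c k‖² ≤ E` and `ν ‖∇u‖² = ν · 4π² Σ |k|² ‖c k‖² ≥ ε` (Parseval). [folklore] -/
theorem windLineFeedsTarget_proof :
    Summit.AnomalousDissipation.AnomalousDissipation.Theses.WindLine.WindLineFeedsTarget := by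
  unfold Theses.WindLine.WindLineFeedsTarget
  intro h
  obtain ⟨ν, E, ε, hν, hν0, hε, hloud⟩ := h
  refine ⟨_, isSmooth_cycForce, isDivFree_cycForce, hasZeroMean_cycForce, ν, E, ε, hν, hν0, hε, fun j => ?_⟩
  refine (hloud j).mono fun N hN => ?_
  have hS : ∀ k ∈ freqBall (d := Fin 3) N, -k ∈ freqBall N := neg_mem_freqBall_of_mem
  obtain ⟨c, hcV, -, hE, hεc⟩ := hN (freqBall N) rfl _ rfl
  obtain ⟨hc, -, h0⟩ := hcV
  have hCsymm : IsConjSymm (coeffExt (freqBall N) c) := hc.1.isConjSymm_coeffExt hS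
  refine ⟨realTrigPoly (freqBall N) (coeffExt (freqBall N) c), ⟨isSmooth_realTrigPoly _ _,
    isDivFree_realTrigPoly hc.2.isTransversal_coeffExt,
    fun k hk => mFourierCoeff_realTrigPoly_eq_zero hS hCsymm hk,
    fun a ha hdiv hband => integral_tested_eq_zero_of_galerkinRHS_eq_zero hS (ν j) isSmooth_cycForce hc h0 ha hdiv
      fun k hk => hband k fun hmem => hk (Finset.mem_of_mem_erase hmem)⟩, ?_, ?_⟩
  · rw [integral_norm_sq_realTrigPoly hS hCsymm, sum_coeffExt (fun _ v => ‖v‖ ^ 2) c]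
    exact hE
  · rw [gradNormSq_eq_toReal_eGradNormSq_holds (isSmooth_realTrigPoly _ _),
      toReal_eGradNormSq_realTrigPoly hS hCsymm, sum_coeffExt (fun k v => freqNormSq k * ‖v‖ ^ 2) c]
    exact hεc

end Summit.AnomalousDissipation.AnomalousDissipation.Theorems

end
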